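import Literature.MathematicalPhysics.QuantumFieldTheory.Balaban1983to89.Node00.TwoRunSitePeierlsCoverFamily
import Literature.MathematicalPhysics.QuantumFieldTheory.Balaban1983to89.B5Eq118OneStroke

/-!
# NODE 00 — THE PEIERLS COVER AT BLOCK GRAIN: a component of `≥ n · L^{dℓ}` finest sites has a block image with a component of `≥ n` points of the
# `ℓ`-fold coarser torus `Site P ℓ`, so it is covered by `animalCoverFamily (SiteTouch (j := ℓ)) n` — entropy `|Site_ℓ| · (3^d − 1)^{2(n−1)}` instead of
# `|Site_0| · (3^d − 1)^{2(n·L^{dℓ} − 1)}`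

Cell `pub-ymgap`, YM-PLAN Track A (HUMAN RULING D-0062; width push D-0149); seat `pub-ymgap-dag-n20-d` (R134 (a) N20 NE7b s3) gen 33 — companion of
`Node00/TwoRunSitePeierlsCover(Family)` (gen 32: `touchingGraph`, `animalCoverFamily`, `exists_mem_animalCoverFamily_siteTouch_of_hasBigComponent`,
`card_animalCoverFamily_siteTouch_le_pred`) and of `B5Eq118OneStroke` (`iterBlockOf ∕ iterBlock ∕ val_iterBlockOf ∕ card_iterBlock`: the `ℓ`-fold block map
`T^{(0)} → T^{(ℓ)}` and its blocks `B^ℓ(y)` of `L^{dℓ}` finest sites).  [LF-II] = [Balaban1989LargeFieldII]; [III] = [Balaban1988Convergent].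

WHY (a located defect of the gen-32 road, numbers not adjectives).  The Peierls assembly `Summits/…/BalabanUVNodesSpineReadingOfRecord13CoPHKComponentSizePeierls`
counts connected `m`-sets of FINEST sites (entropy `|Site_0| · (3^d − 1)^{2(m−1)}`) against an energy letter `ε ^ m`.  A level-`j` large-field region of record is a union
of `𝐃_j`-cubes of `L^j · M · R_j` finest sites per side ([III] p. 256 «unions of `MR_j`-cubes in the lattice `T_{L^{−j}}`»; `Node00.DOfRecord`), so the event
«`Z_j ⊇ S`» has ONE cube's weight fraction for every connected `S` inside one cube: the energy is paid once per CUBE while the union bound pays `(3^d − 1)²` per SITE,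
and the numerical side of that assembly cannot be met by an honest letter.  The repair is to count animals of BLOCKS.  This file supplies the geometric step, with NO
new graph theory: the `ℓ`-fold block map sends touching finest sites to touching (or equal) sites of the coarser torus `Site P ℓ` (★ `siteTouch_iterBlockOf`, label
arithmetic including the wrap-around), hence chains to chains and components into components (`connIn_image_iterBlockOf`, `image_compIn_iterBlockOf_subset`); a set of
finest sites is covered by the blocks over its image, so `|C| ≤ |B^ℓ(C)| · L^{dℓ}` (★ `ncard_le_ncard_image_iterBlockOf_mul`); therefore a component of `≥ n · L^{dℓ}`
finest sites yields a component of `≥ n` coarse sites of the block image (★★ `hasBigComponent_image_iterBlockOf`), and gen-32's cover AT LEVEL `ℓ` applies verbatim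
(★★ `exists_mem_animalCoverFamily_image_iterBlockOf_of_hasBigComponent`: some member `(y, A)` of `animalCoverFamily (SiteTouch (j := ℓ)) n` has `↑A ⊆ B^ℓ-image of Z`,
a family of `≤ |Site_ℓ| · (3^d − 1)^{2(n−1)}` members by `card_animalCoverFamily_siteTouch_le_pred`).  §3 records the block-SATURATED case (a union of blocks — every
`𝐃_j`-cube is one when `L^ℓ` divides its side): there «block meets `Z`» is «block inside `Z`», so the cover member's blocks lie INSIDE the region
(`biUnion_iterBlock_subset_of_subset_image`), the shape an energy letter «`n` whole blocks in the large-field region cost `δ^n`» reads; §4 proves the regions of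
record ARE saturated: an `s`-cube of the torus with `L^ℓ ∣ s` is a union of `ℓ`-blocks (★ `blockSaturated_cubeEnl`, integer label arithmetic on the cover through
`box_stable_of_same_block`), hence so is every member of `unionsOfCubes P s` and every level-`j` domain of `Node00.DOfRecord` for `ℓ ≤ j`
(★ `blockSaturated_of_mem_dOfRecord`: the `𝐃_j`-cubes have `L^j · M · R_j` finest sites per side; `blockSaturated_seq_Λ(_compl)`: the entries `Λ_j` ∕ `Z_j = Λ_jᶜ` of every
admissible sequence of record, whenever `L^ℓ` divides the level-`j` cube side).
HONEST — WHAT THIS IS NOT.  Finite torus geometry and [folklore] chain bookkeeping BY NAME (theorems only, 0 `def`); NO weight, NO measure, NO estimate; the block energy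
letter is NOT typed here and is inhabitable in principle only when the block side `L^ℓ` reaches the `𝐃_j`-cube side (a numeric side condition on Bałaban's `M`, `R_j`,
`p₀`, not checked here); nothing of Bałaban's asserted; NE7 ∕ NE7b ∕ NE7c NOT PRINTED for `d = 4` and NOT proved; no node count moves (typed 28∕28 · discharged 8∕27);
no `sorry`, no `axiom`, no `instance`, no `notation`; one finite four-torus programme at fixed `ε` — NOT ℝ⁴, NOT OS, NOT a mass gap, NOT the Clay problem.
-/

noncomputable section

open scoped BigOperators

namespace Literature.MathematicalPhysics.QuantumFieldTheory.Balaban1983to89.Node00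

open T4Continuum B5Eq118OneStroke

/-! ## §1  Chains and components under a touch-compatible map -/

section Map

variable {α β : Type*} {τ : α → α → Prop} {σ : β → β → Prop}

/-- [folklore] **A TOUCH-COMPATIBLE MAP SENDS CHAINS INSIDE `S` TO CHAINS INSIDE `f '' S`**. [cite: Balaban1989LargeFieldII, (1.84) p.386 (bookkeeping)] -/
theorem ConnIn.map (f : α → β) (hf : ∀ ⦃a b : α⦄, τ a b → σ (f a) (f b)) {S : Set α} {z z' : α} (h : ConnIn τ S z z') :
    ConnIn σ (f '' S) (f z) (f z') := by
  induction h with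
  | refl => exact connIn_refl σ _ _
  | tail _ hl ih => exact Relation.ReflTransGen.tail ih ⟨Set.mem_image_of_mem f hl.1, Set.mem_image_of_mem f hl.2.1, hf hl.2.2⟩

/-- [folklore] … hence the image of the component of `S` through `z` lies in the component of `f '' S` through `f z`. [cite: Balaban1989LargeFieldII, (1.84) p.386 (bookkeeping)] -/
theorem image_compIn_subset_compIn_image (f : α → β) (hf : ∀ ⦃a b : α⦄, τ a b → σ (f a) (f b)) (S : Set α) (z : α) :
    f '' compIn τ S z ⊆ compIn σ (f '' S) (f z) := by
  rintro _ ⟨x, hx, rfl⟩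
  exact (mem_compIn_iff σ _ _ _).2 (ConnIn.map f hf ((mem_compIn_iff τ S z x).1 hx))

end Map

/-! ## §2  The `ℓ`-fold block map on the torus: touching descends, components map into components, the block-grain cover -/

section Torus

variable {P : Params} {ℓ : ℕ}

/-- In the standing range `ℓ ≤ m + K` the finest torus has `L^ℓ` times as many sites per direction as `T^{(ℓ)}`: `2L^{m+K} = 2L^{m+K−ℓ} · L^ℓ`.
[cite: Balaban1987RG1, (0.1) p.251 (bookkeeping)] -/
theorem sitesPerDir_zero_eq_mul_pow (hℓ : ℓ ≤ P.m + P.K) : P.sitesPerDir 0 = P.sitesPerDir ℓ * P.L ^ ℓ := by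
  unfold Params.sitesPerDir
  rw [Nat.sub_zero, mul_assoc, ← pow_add, Nat.sub_add_cancel hℓ]

/-- The `μ`-th coordinate of the `ℓ`-fold block point, as a cast of the integer-divided label. [cite: Balaban1984PropagatorsI, (1.6) p.18 (bookkeeping)] -/
theorem iterBlockOf_apply_eq_natCast (hℓ : ℓ ≤ P.m + P.K) (x : Site P 0) (μ : Fin P.d) :
    (iterBlockOf ℓ x) μ = (((x μ).val / P.L ^ ℓ : ℕ) : ZMod (P.sitesPerDir ℓ)) := by rw [← val_iterBlockOf ℓ hℓ x μ, ZMod.natCast_zmod_val]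

/-- The one-sided step: if `x' = x + e_μ` in the `μ`-th coordinate (torus-wise), the block points agree or differ by `+1` in that coordinate (torus-wise) — including the
wrap-around `x_μ = 2L^{m+K} − 1 ↦ x'_μ = 0`, where the block labels are `2L^{m+K−ℓ} − 1 ↦ 0`. [cite: Balaban1989LargeFieldII, (1.84) p.386 (bookkeeping)] -/
theorem iterBlockOf_sub_of_sub_eq_one (hℓ : ℓ ≤ P.m + P.K) {x x' : Site P 0} {μ : Fin P.d} (h : x' μ - x μ = 1) :
    (iterBlockOf ℓ x') μ - (iterBlockOf ℓ x) μ = 0 ∨ (iterBlockOf ℓ x') μ - (iterBlockOf ℓ x) μ = 1 := by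
  set q : ℕ := P.L ^ ℓ with hq
  set n : ℕ := P.sitesPerDir ℓ with hn
  have hq0 : 0 < q := pow_pos P.L_pos _
  have hn1 : 1 < n := P.one_lt_sitesPerDir ℓ
  have hN : P.sitesPerDir 0 = n * q := sitesPerDir_zero_eq_mul_pow hℓ
  have hx' : x' μ = x μ + 1 := by rw [← h]; abel
  have hval : (x' μ).val = ((x μ).val + 1) % P.sitesPerDir 0 := by
    rw [hx', ZMod.val_add, ZMod.val_one]
  have hlt : (x μ).val < P.sitesPerDir 0 := ZMod.val_lt (x μ)
  rw [iterBlockOf_apply_eq_natCast hℓ x μ, iterBlockOf_apply_eq_natCast hℓ x' μ]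
  by_cases hwrap : (x μ).val + 1 < P.sitesPerDir 0
  · -- no wrap-around: the fine label goes up by one
    rw [Nat.mod_eq_of_lt hwrap] at hval
    rw [hval, Nat.succ_div]
    by_cases hdvd : q ∣ (x μ).val + 1
    · right
      rw [if_pos hdvd]
      push_cast
      ring
    · left
      rw [if_neg hdvd, add_zero, sub_self]
  · -- wrap-around: `x_μ` is the last label, `x'_μ = 0`
    have heq : (x μ).val + 1 = P.sitesPerDir 0 := by omega
    rw [heq, Nat.mod_self] at hval
    have hxv : (x μ).val = n * q - 1 := by omega
    have hdiv : (x μ).val / q = n - 1 := by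
      rw [hxv]
      refine Nat.div_eq_of_lt_le ?_ ?_
      · have : (n - 1) * q = n * q - q := Nat.sub_one_mul n q
        omega
      · rw [Nat.sub_add_cancel hn1.le]
        have : 1 ≤ n * q := Nat.one_le_iff_ne_zero.2 (Nat.mul_ne_zero (by omega) hq0.ne')
        omega
    right
    rw [hval, Nat.zero_div, hdiv, Nat.cast_sub hn1.le, Nat.cast_zero, Nat.cast_one, ZMod.natCast_self]
    ring

/-- ★ **TOUCHING FINEST SITES HAVE TOUCHING (OR EQUAL) `ℓ`-FOLD BLOCK POINTS** in the coarser torus `Site P ℓ` (`SiteTouch` is reflexive, so «or equal» is included):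
coordinatewise the labels divided by `L^ℓ` differ by `0`, `±1` torus-wise when the labels do. [cite: Balaban1989LargeFieldII, (1.84) p.386 (bookkeeping)] -/
theorem siteTouch_iterBlockOf (hℓ : ℓ ≤ P.m + P.K) {x x' : Site P 0} (h : SiteTouch x x') : SiteTouch (iterBlockOf ℓ x) (iterBlockOf ℓ x') := by
  intro μ
  rcases h μ with h0 | h1 | h2
  · -- equal coordinates ⇒ equal block coordinates
    have hxx : x' μ = x μ := sub_eq_zero.1 h0
    left
    rw [iterBlockOf_apply_eq_natCast hℓ x μ, iterBlockOf_apply_eq_natCast hℓ x' μ, hxx, sub_self]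
  · rcases iterBlockOf_sub_of_sub_eq_one hℓ h1 with h | h
    · exact Or.inl h
    · exact Or.inr (Or.inl h)
  · -- `x' = x − e_μ`: apply the one-sided step to the swapped pair
    have h1' : x μ - x' μ = 1 := by
      have : x μ - x' μ = -(x' μ - x μ) := (neg_sub (x' μ) (x μ)).symm
      rw [this, h2, neg_neg]
    have hneg : (iterBlockOf ℓ x') μ - (iterBlockOf ℓ x) μ = -((iterBlockOf ℓ x) μ - (iterBlockOf ℓ x') μ) := (neg_sub _ _).symm
    rcases iterBlockOf_sub_of_sub_eq_one hℓ h1' with h | h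
    · exact Or.inl (by rw [hneg, h, neg_zero])
    · exact Or.inr (Or.inr (by rw [hneg, h]))

/-- **CHAINS OF TOUCHING FINEST SITES INSIDE `Z` MAP TO CHAINS OF TOUCHING COARSE SITES INSIDE THE BLOCK IMAGE OF `Z`**. [cite: Balaban1989LargeFieldII, (1.84) p.386 (bookkeeping)] -/
theorem connIn_image_iterBlockOf (hℓ : ℓ ≤ P.m + P.K) {Z : Set (Site P 0)} {z x : Site P 0} (h : ConnIn SiteTouch Z z x) :
    ConnIn SiteTouch (iterBlockOf ℓ '' Z) (iterBlockOf ℓ z) (iterBlockOf ℓ x) :=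
  ConnIn.map (iterBlockOf ℓ) (fun _ _ hab => siteTouch_iterBlockOf hℓ hab) h

/-- **THE BLOCK IMAGE OF A COMPONENT LIES IN A COMPONENT OF THE BLOCK IMAGE**. [cite: Balaban1989LargeFieldII, (1.84) p.386 (bookkeeping)] -/
theorem image_compIn_iterBlockOf_subset (hℓ : ℓ ≤ P.m + P.K) (Z : Set (Site P 0)) (z : Site P 0) :
    iterBlockOf ℓ '' compIn SiteTouch Z z ⊆ compIn SiteTouch (iterBlockOf ℓ '' Z) (iterBlockOf ℓ z) :=
  image_compIn_subset_compIn_image (iterBlockOf ℓ) (fun _ _ hab => siteTouch_iterBlockOf hℓ hab) Z z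

/-- **A SET OF FINEST SITES IS COVERED BY THE BLOCKS OVER ITS BLOCK IMAGE** (`x ∈ B^ℓ(B^ℓ-point of x)`). [cite: Balaban1984PropagatorsI, (1.18) p.20 (bookkeeping)] -/
theorem subset_biUnion_iterBlock_image (ℓ : ℕ) (C : Set (Site P 0)) : C ⊆ ⋃ b ∈ iterBlockOf ℓ '' C, (↑(iterBlock ℓ b) : Set (Site P 0)) := by
  intro x hx
  simp only [Set.mem_iUnion, Set.mem_image, exists_prop, Finset.mem_coe, mem_iterBlock]
  exact ⟨iterBlockOf ℓ x, ⟨x, hx, rfl⟩, rfl⟩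

/-- ★ **`|C| ≤ |B^ℓ(C)| · L^{dℓ}`**: a set of finest sites has at most `L^{dℓ}` times as many points as its block image (each block has `L^{dℓ}` sites, `card_iterBlock`;
standing range `ℓ ≤ m + K`). [cite: Balaban1984PropagatorsI, (1.18) p.20 (bookkeeping)] -/
theorem ncard_le_ncard_image_iterBlockOf_mul (hℓ : ℓ ≤ P.m + P.K) (C : Set (Site P 0)) :
    C.ncard ≤ (iterBlockOf ℓ '' C).ncard * (P.L ^ P.d) ^ ℓ := by
  classical
  set T : Finset (Site P ℓ) := (iterBlockOf ℓ '' C).toFinset with hT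
  have hcov : C ⊆ ↑(T.biUnion (iterBlock ℓ)) := by
    intro x hx
    rw [Finset.coe_biUnion, Set.mem_iUnion₂]
    refine ⟨iterBlockOf ℓ x, ?_, ?_⟩
    · rw [Finset.mem_coe, hT, Set.mem_toFinset]
      exact ⟨x, hx, rfl⟩
    · rw [Finset.mem_coe, mem_iterBlock]
  calc C.ncard ≤ (↑(T.biUnion (iterBlock ℓ)) : Set (Site P 0)).ncard := Set.ncard_le_ncard hcov (Set.toFinite _)
    _ = (T.biUnion (iterBlock ℓ)).card := Set.ncard_coe_finset _
    _ ≤ ∑ b ∈ T, (iterBlock ℓ b).card := Finset.card_biUnion_le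
    _ = ∑ _b ∈ T, (P.L ^ P.d) ^ ℓ := Finset.sum_congr rfl fun b _ => card_iterBlock ℓ hℓ b
    _ = T.card * (P.L ^ P.d) ^ ℓ := by rw [Finset.sum_const, smul_eq_mul]
    _ = (iterBlockOf ℓ '' C).ncard * (P.L ^ P.d) ^ ℓ := by rw [hT, Set.ncard_eq_toFinset_card']

/-- ★★ **A COMPONENT OF `≥ n · L^{dℓ}` FINEST SITES GIVES A COMPONENT OF `≥ n` COARSE SITES OF THE BLOCK IMAGE** (same `SiteTouch` ∕ `HasBigComponent` ∕ `bigOfCard`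
machinery, one lattice up; any level tag `lvl`, thresholds `m lvl ≥ n · L^{dℓ}`). [cite: Balaban1989LargeFieldII, (1.80) p.384 (bookkeeping)] -/
theorem hasBigComponent_image_iterBlockOf (hℓ : ℓ ≤ P.m + P.K) {m : ℕ → ℕ} {lvl n : ℕ} (hmn : n * (P.L ^ P.d) ^ ℓ ≤ m lvl) {Z : Set (Site P 0)}
    (h : HasBigComponent SiteTouch (bigOfCard m lvl) Z) : HasBigComponent SiteTouch (bigOfCard (fun _ => n) lvl) (iterBlockOf ℓ '' Z) := by
  obtain ⟨z, hz, hbig⟩ := (hasBigComponent_iff SiteTouch _ _).1 h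
  rw [bigOfCard_iff] at hbig
  refine (hasBigComponent_iff SiteTouch _ _).2 ⟨iterBlockOf ℓ z, Set.mem_image_of_mem _ hz, ?_⟩
  rw [bigOfCard_iff]
  have hQ : 0 < (P.L ^ P.d) ^ ℓ := pow_pos (pow_pos P.L_pos _) _
  have h1 : n * (P.L ^ P.d) ^ ℓ ≤ (iterBlockOf ℓ '' compIn SiteTouch Z z).ncard * (P.L ^ P.d) ^ ℓ :=
    hmn.trans (hbig.trans (ncard_le_ncard_image_iterBlockOf_mul hℓ _))
  exact (Nat.le_of_mul_le_mul_right h1 hQ).trans (Set.ncard_le_ncard (image_compIn_iterBlockOf_subset hℓ Z z) (Set.toFinite _))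

/-- ★★ **THE PEIERLS COVER AT BLOCK GRAIN**: a region `Z` of finest sites with a component of at least `m lvl ≥ n · L^{dℓ}` sites (`n ≥ 1`) contains, in its block image,
the connected coarse `n`-set of some member of `animalCoverFamily (SiteTouch (j := ℓ)) n` — a family of `≤ |Site_ℓ| · (3^d − 1)^{2(n−1)}` members
(`card_animalCoverFamily_siteTouch_le_pred` at level `ℓ`). [cite: Balaban1989LargeFieldII, (1.80) p.384 (bookkeeping)] -/
theorem exists_mem_animalCoverFamily_image_iterBlockOf_of_hasBigComponent (hℓ : ℓ ≤ P.m + P.K) {m : ℕ → ℕ} {lvl n : ℕ} (h1 : 1 ≤ n)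
    (hmn : n * (P.L ^ P.d) ^ ℓ ≤ m lvl) {Z : Set (Site P 0)} (h : HasBigComponent SiteTouch (bigOfCard m lvl) Z) :
    ∃ p ∈ animalCoverFamily (SiteTouch (P := P) (j := ℓ)) n, (p.2 : Set (Site P ℓ)) ⊆ iterBlockOf ℓ '' Z :=
  exists_mem_animalCoverFamily_siteTouch_of_hasBigComponent (m := fun _ => n) (lvl := lvl) h1 (hasBigComponent_image_iterBlockOf hℓ hmn h)

/-! ## §3  Block-saturated regions: «block meets `Z`» is «block inside `Z`» -/

/-- **IN A BLOCK-SATURATED REGION EVERY BLOCK THAT MEETS IT LIES INSIDE IT** (saturation stated as a hypothesis shape: `Z` is a union of `ℓ`-blocks).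
[cite: Balaban1988Convergent, (2.1) p.254 (bookkeeping)] -/
theorem iterBlock_subset_of_mem_image {Z : Set (Site P 0)} (hsat : ∀ ⦃x x' : Site P 0⦄, iterBlockOf ℓ x = iterBlockOf ℓ x' → x ∈ Z → x' ∈ Z)
    {b : Site P ℓ} (hb : b ∈ iterBlockOf ℓ '' Z) : (↑(iterBlock ℓ b) : Set (Site P 0)) ⊆ Z := by
  obtain ⟨x, hx, rfl⟩ := hb
  intro x' hx'
  rw [Finset.mem_coe, mem_iterBlock] at hx'
  exact hsat hx'.symm hx

/-- … so the blocks of a coarse set inside the block image of a saturated region lie inside the region — the shape a block energy letter «`n` whole blocks in the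
large-field region» reads. [cite: Balaban1988Convergent, (2.1) p.254 (bookkeeping)] -/
theorem biUnion_iterBlock_subset_of_subset_image {Z : Set (Site P 0)} (hsat : ∀ ⦃x x' : Site P 0⦄, iterBlockOf ℓ x = iterBlockOf ℓ x' → x ∈ Z → x' ∈ Z)
    {A : Set (Site P ℓ)} (hA : A ⊆ iterBlockOf ℓ '' Z) : (⋃ b ∈ A, (↑(iterBlock ℓ b) : Set (Site P 0))) ⊆ Z := by
  intro x hx
  simp only [Set.mem_iUnion, exists_prop] at hx
  obtain ⟨b, hb, hxb⟩ := hx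
  exact iterBlock_subset_of_mem_image hsat (hA hb) hxb

/-- Conversely a block inside `Z` (blocks are nonempty in the standing range) has its coarse site in the block image — so for saturated `Z` the two events coincide.
[cite: Balaban1988Convergent, (2.1) p.254 (bookkeeping)] -/
theorem mem_image_iterBlockOf_of_iterBlock_subset (hℓ : ℓ ≤ P.m + P.K) {Z : Set (Site P 0)} {b : Site P ℓ} (hb : (↑(iterBlock ℓ b) : Set (Site P 0)) ⊆ Z) :
    b ∈ iterBlockOf ℓ '' Z := by
  have hne : (iterBlock ℓ b).Nonempty := by
    rw [← Finset.card_pos, card_iterBlock ℓ hℓ b]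
    exact pow_pos (pow_pos P.L_pos _) _
  obtain ⟨x, hx⟩ := hne
  exact ⟨x, hb (Finset.mem_coe.2 hx), (mem_iterBlock ℓ b x).1 hx⟩

/-- Saturation passes to the complement (keys store the small-field region `Λ_j = Z_jᶜ`). [cite: Balaban1988Convergent, (2.3) p.255 (bookkeeping)] -/
theorem blockSaturated_compl {Z : Set (Site P 0)} (hsat : ∀ ⦃x x' : Site P 0⦄, iterBlockOf ℓ x = iterBlockOf ℓ x' → x ∈ Z → x' ∈ Z) :
    ∀ ⦃x x' : Site P 0⦄, iterBlockOf ℓ x = iterBlockOf ℓ x' → x ∈ Zᶜ → x' ∈ Zᶜ :=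
  fun _ _ hxx hx hx' => hx (hsat hxx.symm hx')

/-- A union of `ℓ`-blocks is saturated. [cite: Balaban1988Convergent, (2.1) p.254 (bookkeeping)] -/
theorem blockSaturated_biUnion_iterBlock (A : Set (Site P ℓ)) :
    ∀ ⦃x x' : Site P 0⦄, iterBlockOf ℓ x = iterBlockOf ℓ x' → (x ∈ ⋃ b ∈ A, (↑(iterBlock ℓ b) : Set (Site P 0))) → x' ∈ ⋃ b ∈ A, (↑(iterBlock ℓ b) : Set (Site P 0)) := by
  intro x x' hxx hx
  simp only [Set.mem_iUnion, exists_prop, Finset.mem_coe, mem_iterBlock] at hx ⊢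
  obtain ⟨b, hb, hxb⟩ := hx
  exact ⟨b, hb, hxx ▸ hxb⟩

/-- A saturated region IS the union of the blocks over its block image. [cite: Balaban1988Convergent, (2.1) p.254 (bookkeeping)] -/
theorem eq_biUnion_iterBlock_image_of_saturated {Z : Set (Site P 0)} (hsat : ∀ ⦃x x' : Site P 0⦄, iterBlockOf ℓ x = iterBlockOf ℓ x' → x ∈ Z → x' ∈ Z) :
    Z = ⋃ b ∈ iterBlockOf ℓ '' Z, (↑(iterBlock ℓ b) : Set (Site P 0)) :=
  Set.Subset.antisymm (subset_biUnion_iterBlock_image ℓ Z) (biUnion_iterBlock_subset_of_subset_image hsat subset_rfl)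

end Torus

/-! ## §4  The cubes of record are block-saturated: aligned cubes, unions of cubes, the level-`j` domains `𝐃_j` for `ℓ ≤ j` -/

section Cubes

open B14.Eq213MaximalDomains B15Eq112TorusCover B14DomainGeom

variable {P : Params} {ℓ : ℕ}

/-- [folklore] One coordinate of the saturation argument, in `ℤ`: a point `z` of an aligned box `[A, A + S)` (`A`, `S` multiples of `Q > 0`), moved inside its own
`Q`-block to `z + (v' − v)` where `v ≡ z (mod Q·n)` and `v, v'` lie in one `Q`-block, stays in the box. [cite: Balaban1988Convergent, (2.1) p.254 (bookkeeping)] -/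
theorem box_stable_of_same_block {Q S' k n t z v v' : ℤ} (hQ : 0 < Q) (hzlo : Q * S' * k ≤ z) (hzhi : z ≤ Q * S' * k + Q * S' - 1)
    (hzv : z = v + Q * n * t) (hb : v / Q = v' / Q) :
    Q * S' * k ≤ z + (v' - v) ∧ z + (v' - v) ≤ Q * S' * k + Q * S' - 1 := by
  -- decompositions `v = Q·(v/Q) + v%Q`, `v' = Q·(v'/Q) + v'%Q`, `z = Q·(z/Q) + z%Q`
  have hvd := Int.mul_ediv_add_emod v Q
  have hv'd := Int.mul_ediv_add_emod v' Q
  have hzd := Int.mul_ediv_add_emod z Q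
  have hQ0 : Q ≠ 0 := hQ.ne'
  have hzmod : z % Q = v % Q := by
    rw [hzv, mul_assoc, Int.add_mul_emod_self_left]
  have hr'lt : v' % Q < Q := Int.emod_lt_of_pos v' hQ
  have hr'0 : 0 ≤ v' % Q := Int.emod_nonneg v' hQ0
  -- the block base `c = Q·(z/Q)` satisfies `A ≤ c` and `c + Q ≤ A + S`
  have hA : Q * S' * k / Q = S' * k := by
    rw [mul_assoc, Int.mul_ediv_cancel_left _ hQ0]
  have hclo : Q * S' * k ≤ Q * (z / Q) := by
    have h1 : Q * S' * k / Q ≤ z / Q := Int.ediv_le_ediv hQ hzlo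
    rw [hA] at h1
    calc Q * S' * k = Q * (S' * k) := by ring
      _ ≤ Q * (z / Q) := mul_le_mul_of_nonneg_left h1 hQ.le
  have hchi : Q * (z / Q) + Q ≤ Q * S' * k + Q * S' := by
    have h1 : Q * (z / Q) ≤ z := Int.mul_ediv_self_le hQ0
    have h2 : Q * (z / Q) < Q * (S' * k + S') := by
      calc Q * (z / Q) ≤ z := h1
        _ < Q * (S' * k + S') := by linarith
    have h3 : z / Q < S' * k + S' := lt_of_mul_lt_mul_left h2 hQ.le
    have h4 : z / Q + 1 ≤ S' * k + S' := h3
    calc Q * (z / Q) + Q = Q * (z / Q + 1) := by ring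
      _ ≤ Q * (S' * k + S') := mul_le_mul_of_nonneg_left h4 hQ.le
      _ = Q * S' * k + Q * S' := by ring
  -- `z + (v' − v) = c + v'%Q`
  have hz' : z + (v' - v) = Q * (z / Q) + v' % Q := by
    have e1 : v' - v = v' % Q - v % Q := by
      have : Q * (v / Q) = Q * (v' / Q) := by rw [hb]
      linarith
    linarith
  constructor <;> linarith

/-- **AN ALIGNED CUBE OF THE TORUS IS BLOCK-SATURATED**: if `L^ℓ` divides the side `s`, the `s`-cube `cubeEnl P s a 0` (the `𝐃_j`-cubes of record have `s = L^j · M · R_j`) is a union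
of `ℓ`-blocks — with a finest site it contains every finest site with the same `ℓ`-fold block point (standing range `ℓ ≤ m + K`). [cite: Balaban1988Convergent, (2.1) p.254 (bookkeeping)] -/
theorem blockSaturated_cubeEnl (hℓ : ℓ ≤ P.m + P.K) {s : ℕ} (hdvd : P.L ^ ℓ ∣ s) (a : Pt P.d) :
    ∀ ⦃x x' : Site P 0⦄, iterBlockOf ℓ x = iterBlockOf ℓ x' → x ∈ cubeEnl P s a 0 → x' ∈ cubeEnl P s a 0 := by
  intro x x' hxx hx
  obtain ⟨S', hS'⟩ := hdvd
  set Q : ℤ := ((P.L ^ ℓ : ℕ) : ℤ) with hQdef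
  have hQ : 0 < Q := by
    rw [hQdef]
    exact_mod_cast pow_pos P.L_pos ℓ
  have hN : ((P.sitesPerDir 0 : ℕ) : ℤ) = Q * (P.sitesPerDir ℓ : ℕ) := by
    rw [sitesPerDir_zero_eq_mul_pow hℓ, hQdef]
    push_cast
    ring
  -- a cover point `z` of `x` in the cube
  unfold cubeEnl at hx ⊢
  obtain ⟨z, hz, hzx⟩ := hx
  simp only [Nat.zero_mul, Nat.cast_zero] at hz ⊢
  -- the moved point
  refine ⟨fun μ => z μ + (((x' μ).val : ℤ) - ((x μ).val : ℤ)), ?_, ?_⟩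
  · intro μ
    have hzμ := hz μ
    -- `z μ ≡ (x μ).val` modulo the period
    have hcong : ∃ t : ℤ, z μ = ((x μ).val : ℤ) + Q * (P.sitesPerDir ℓ : ℕ) * t := by
      have h1 : ((z μ : ℤ) : ZMod (P.sitesPerDir 0)) = (((x μ).val : ℤ) : ZMod (P.sitesPerDir 0)) := by
        rw [Int.cast_natCast, ZMod.natCast_zmod_val]
        exact congrFun hzx μ
      obtain ⟨t, ht⟩ := (ZMod.intCast_eq_intCast_iff_dvd_sub _ _ (P.sitesPerDir 0)).1 h1.symm
      refine ⟨t, ?_⟩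
      rw [← hN]
      linarith
    obtain ⟨t, ht⟩ := hcong
    have hb : ((x μ).val : ℤ) / Q = ((x' μ).val : ℤ) / Q := by
      have h : (x μ).val / P.L ^ ℓ = (x' μ).val / P.L ^ ℓ := by
        rw [← val_iterBlockOf ℓ hℓ x μ, ← val_iterBlockOf ℓ hℓ x' μ, hxx]
      rw [hQdef]
      exact_mod_cast congrArg (Nat.cast : ℕ → ℤ) h
    have hlo : Q * (S' : ℤ) * a μ ≤ z μ := by
      have : ((s : ℕ) : ℤ) = Q * (S' : ℤ) := by rw [hS', hQdef]; push_cast; ring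
      rw [← this]; linarith [hzμ.1]
    have hhi : z μ ≤ Q * (S' : ℤ) * a μ + Q * (S' : ℤ) - 1 := by
      have : ((s : ℕ) : ℤ) = Q * (S' : ℤ) := by rw [hS', hQdef]; push_cast; ring
      rw [← this]; linarith [hzμ.2]
    have hmain := box_stable_of_same_block (k := a μ) hQ hlo hhi ht hb
    have : ((s : ℕ) : ℤ) = Q * (S' : ℤ) := by rw [hS', hQdef]; push_cast; ring
    rw [this]
    exact ⟨by linarith [hmain.1], by linarith [hmain.2]⟩
  · funext μ
    have hzxμ : ((z μ : ℤ) : ZMod (P.sitesPerDir 0)) = x μ := congrFun hzx μ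
    simp only [cover_apply, Int.cast_add, Int.cast_sub, Int.cast_natCast, ZMod.natCast_zmod_val, hzxμ]
    abel

/-- **A UNION OF ALIGNED CUBES IS BLOCK-SATURATED** (`L^ℓ` divides the side). [cite: Balaban1988Convergent, (2.1) p.254 (bookkeeping)] -/
theorem blockSaturated_of_mem_unionsOfCubes (hℓ : ℓ ≤ P.m + P.K) {s : ℕ} (hdvd : P.L ^ ℓ ∣ s) {Z : Set (Site P 0)} (hZ : Z ∈ unionsOfCubes P s) :
    ∀ ⦃x x' : Site P 0⦄, iterBlockOf ℓ x = iterBlockOf ℓ x' → x ∈ Z → x' ∈ Z := by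
  obtain ⟨A, -, rfl⟩ := (mem_unionsOfCubes_iff P s Z).1 hZ
  intro x x' hxx hx
  simp only [Set.mem_iUnion, exists_prop] at hx ⊢
  obtain ⟨a, ha, hxa⟩ := hx
  exact ⟨a, ha, blockSaturated_cubeEnl hℓ hdvd a hxx hxa⟩

/-- **A LEVEL-`j` DOMAIN OF RECORD IS `ℓ`-BLOCK-SATURATED WHENEVER `L^ℓ` DIVIDES ITS CUBE SIDE `L^j · M · R_j`** (standing range `ℓ ≤ m + K`; for `ℓ ≤ j` always —
next lemma; for `ℓ > j` a numeric condition on `M · R_j`, both powers of `L` in print). [cite: Balaban1988Convergent, (2.1) p.254 (bookkeeping)] -/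
theorem blockSaturated_of_mem_dOfRecord_of_dvd (F : T4Family) (ν : Stage7Numerics) (M : ℕ) (g : ℕ → ℝ) (K : ℕ) {j ℓ : ℕ} (hℓ : ℓ ≤ F.m + K)
    (hdvd : F.L ^ ℓ ∣ dCubeSide F.L M (RkOfRecord F.L ν.r (g j)) j) {Z : Set (Site (F.P K) 0)} (hZ : Z ∈ DOfRecord F ν M g K j) :
    ∀ ⦃x x' : Site (F.P K) 0⦄, iterBlockOf ℓ x = iterBlockOf ℓ x' → x ∈ Z → x' ∈ Z :=
  blockSaturated_of_mem_unionsOfCubes (P := F.P K) hℓ hdvd hZ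

/-- **THE LEVEL-`j` DOMAINS OF RECORD ARE `ℓ`-BLOCK-SATURATED FOR EVERY `ℓ ≤ j`** (their cubes have `L^j · M · R_j` finest sites per side, a multiple of `L^ℓ`; standing range
`ℓ ≤ m + K`) — so for the large-field regions `Z_j = Λ_jᶜ` of the keys of record «an `ℓ`-block meets `Z_j`» is «it lies inside `Z_j`» (`iterBlock_subset_of_mem_image`,
`blockSaturated_compl`). [cite: Balaban1988Convergent, (2.1) p.254 (bookkeeping)] -/
theorem blockSaturated_of_mem_dOfRecord (F : T4Family) (ν : Stage7Numerics) (M : ℕ) (g : ℕ → ℝ) (K : ℕ) {j ℓ : ℕ} (hℓj : ℓ ≤ j) (hℓ : ℓ ≤ F.m + K)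
    {Z : Set (Site (F.P K) 0)} (hZ : Z ∈ DOfRecord F ν M g K j) :
    ∀ ⦃x x' : Site (F.P K) 0⦄, iterBlockOf ℓ x = iterBlockOf ℓ x' → x ∈ Z → x' ∈ Z :=
  blockSaturated_of_mem_dOfRecord_of_dvd F ν M g K hℓ ((pow_dvd_pow _ hℓj).mul_right _ |>.mul_right _) hZ

/-- **THE SMALL-FIELD ENTRIES `Λ_j` OF EVERY ADMISSIBLE SEQUENCE OF RECORD ARE `ℓ`-BLOCK-SATURATED** when `L^ℓ` divides the level-`j` cube side (inside the window by
admissibility `Chain21.memΛ`, outside it `Λ_j = ∅`). [cite: Balaban1988Convergent, (2.1)–(2.3) p.254–255 (bookkeeping)] -/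
theorem blockSaturated_seq_Λ (F : T4Family) (ν : Stage7Numerics) (M : ℕ) (g : ℕ → ℝ) (K k : ℕ) (s : B14.Eq218Concrete.Seq (DOfRecord F ν M g K) k) {j ℓ : ℕ}
    (hℓ : ℓ ≤ F.m + K) (hdvd : F.L ^ ℓ ∣ dCubeSide F.L M (RkOfRecord F.L ν.r (g j)) j) :
    ∀ ⦃x x' : Site (F.P K) 0⦄, iterBlockOf ℓ x = iterBlockOf ℓ x' → x ∈ s.Λ j → x' ∈ s.Λ j := by
  by_cases hj : 1 ≤ j ∧ j ≤ k
  · exact blockSaturated_of_mem_dOfRecord_of_dvd F ν M g K hℓ hdvd (s.chain.memΛ j hj.1 hj.2)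
  · intro x x' _ hx
    rw [s.Λ_off j hj] at hx
    exact hx.elim

/-- … hence so are the LARGE-FIELD REGIONS `Z_j = Λ_jᶜ` of every admissible sequence of record: for them «an `ℓ`-block meets `Z_j`» is «it lies inside `Z_j`»
(`iterBlock_subset_of_mem_image`). [cite: Balaban1988Convergent, (2.3) p.255 (bookkeeping)] -/
theorem blockSaturated_seq_Λ_compl (F : T4Family) (ν : Stage7Numerics) (M : ℕ) (g : ℕ → ℝ) (K k : ℕ) (s : B14.Eq218Concrete.Seq (DOfRecord F ν M g K) k) {j ℓ : ℕ}
    (hℓ : ℓ ≤ F.m + K) (hdvd : F.L ^ ℓ ∣ dCubeSide F.L M (RkOfRecord F.L ν.r (g j)) j) :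
    ∀ ⦃x x' : Site (F.P K) 0⦄, iterBlockOf ℓ x = iterBlockOf ℓ x' → x ∈ (s.Λ j)ᶜ → x' ∈ (s.Λ j)ᶜ :=
  blockSaturated_compl (blockSaturated_seq_Λ F ν M g K k s hℓ hdvd)

/-- The divisibility is automatic for `ℓ ≤ j`. [cite: Balaban1988Convergent, (2.1) p.254 (bookkeeping)] -/
theorem pow_dvd_dCubeSide_of_le (L M R : ℕ) {j ℓ : ℕ} (hℓj : ℓ ≤ j) : L ^ ℓ ∣ dCubeSide L M R j := (pow_dvd_pow _ hℓj).mul_right _ |>.mul_right _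

end Cubes

end Literature.MathematicalPhysics.QuantumFieldTheory.Balaban1983to89.Node00

end
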